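import Summits.CriticalPhenomena.PercolationContinuityZ3.Theorems.PercNearOneGluingNoHeavyQuantRushbrookeInequality
import Summits.CriticalPhenomena.PercolationContinuityZ3.Theorems.PercNearOneGluingNoHeavyQuantKappaTwiceDifferentiableZ2
import HarnessLib

/-!
# RUSHBROOKE ON `ℤ²`: `θ'(q) ≤ A·√(χ^f(q))` for `q ∈ (1/2, 3/4)` — the planar amplitude form "`2β + γ' ≥ 2`" (Kesten's `κ ∈ C²`
# makes the specific-heat term bounded) — quant lane, METHOD = differential inequalities near `p_c`, seat p4 gen 34, file 10

builds on p205010 (kernel theorem, internal audit signed; external expert review pending).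
Status sentence for p205010: "θ(p_c) = 0 on ℤ^d, all d ≥ 2 — kernel-verified (Lean 4/Mathlib, standard axioms); internal
adversarial audit SIGNED 2026-08-20 04:29Z; external expert review pending."  (Nothing in THIS file uses p205010.)

Seat `prim-quant-p4`, `--supports stmt-CriticalPhenomena-4575`; pure proofs, no definitions (`local notation3` only).
Inputs: file 1 (`Thermo.sq_deriv_theta_le`: `(θ')² ≤ χ^f(κ'' + 2d(1−θ)/(q(1−q))²)` on `(p_c,1)`, every `d ≥ 2`) and Kesten's
Theorem 9.4 on `ℤ²` (gen 30, `KappaZ2.kappa_contDiffOn_two`: `κ ∈ C²(0,1)`), `p_c(ℤ²) = 1/2` (Kesten 1980, tree).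

* **`ThermoZ2.deriv_theta_le_mul_sqrt_chiF`**: there is `A ≥ 0` with `θ'(q) ≤ A·√(χ^f(q))` for all `q ∈ (1/2, 3/4)` on `ℤ²`
  (`A = √(A₀ + 256)`, `A₀ = max_{[1/2,3/4]} |κ''|`).  Reading: on `ℤ²` the derivative of the percolation probability is controlled
  by the square root of the finite-cluster susceptibility near `p_c⁺`; in exponents, `1 − β ≤ γ'/2`, i.e. **`2β + γ' ≥ 2`**
  (Rushbrooke with `α' ≤ 0`), unconditionally as an amplitude inequality (`5/18 + 43/18 = 8/3 ≥ 2` for the conjectured values).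

HONEST STATUS.  A corollary of file 1 and Kesten's `C²` theorem, NEW AS TYPED; both `θ'` and `χ^f` diverge at `1/2⁺` and no rate
for either is claimed; (T1)/(T2) and the lane's honest sentence UNCHANGED.

## References
* R. Durrett, B. Nguyen, Comm. Math. Phys. 99 (1985) 253–269, §3 p. 261 (Rushbrooke) [DurrettNguyen1985].
* H. Kesten, *Percolation Theory for Mathematicians* (1982), Thm. 9.4 [Kesten1982].
-/

noncomputable section

namespace Summit.CriticalPhenomena.PercolationContinuityZ3.Theorems

open MeasureTheory Set Filter Topology Literature.Probability.Percolation Literature.Probability.LatticeModels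
open scoped Classical ENNReal

namespace ThermoZ2

/-- `TH[s] = θ(prm s)` on `ℤ²`. -/
local notation3 "TH[" s "]" => theta (zdGraph 2) 0 (GhostField.prm s)

/-- `CHI[s] = χ^f(prm s)` on `ℤ²` (real). -/
local notation3 "CHI[" s "]" => (meanClusterSize (zdGraph 2) (0 : Site 2) (GhostField.prm s)).toReal

/-- `KAP = κ ∘ prm` on `ℤ²`. -/
local notation3 "KAP" => fun s : ℝ => kappa (zdGraph 2) 0 (GhostField.prm s)

/-- `κ''` is continuous on `(0,1)` on `ℤ²` (Kesten's Thm. 9.4, tree). [cite: Kesten1982, Thm. 9.4] -/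
theorem continuousOn_deriv_deriv_kappa : ContinuousOn (deriv (deriv KAP)) (Set.Ioo (0 : ℝ) 1) :=
  ((KappaZ2.kappa_contDiffOn_two).deriv_of_isOpen (m := 1) isOpen_Ioo (by norm_cast)).continuousOn_deriv_of_isOpen
    isOpen_Ioo le_rfl

/-- **RUSHBROOKE ON `ℤ²` (amplitude form of `2β + γ' ≥ 2`)**: there is `A ≥ 0` such that `θ'(q) ≤ A · √(χ^f(q))` for every
`q ∈ (1/2, 3/4)`. [cite: DurrettNguyen1985, §3 p. 261] [cite: Kesten1982, Thm. 9.4] -/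
theorem deriv_theta_le_mul_sqrt_chiF :
    ∃ A : ℝ, 0 ≤ A ∧ ∀ q ∈ Set.Ioo (1 / 2 : ℝ) (3 / 4),
      deriv (fun s : ℝ => TH[s]) q ≤ A * Real.sqrt CHI[q] := by
  have hpc : (criticalProbI 2 : ℝ) = 1 / 2 := by rw [coe_criticalProbI, kesten_criticalProb_Z2_holds]
  -- `|κ''| ≤ A₀` on `[1/2, 3/4]`
  have hsub : Set.Icc (1 / 2 : ℝ) (3 / 4) ⊆ Set.Ioo (0 : ℝ) 1 := fun q hq => ⟨by linarith [hq.1], by linarith [hq.2]⟩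
  obtain ⟨A₀, hA₀⟩ := isCompact_Icc.exists_bound_of_continuousOn (continuousOn_deriv_deriv_kappa.mono hsub)
  have hA₀0 : 0 ≤ A₀ := (norm_nonneg _).trans (hA₀ (1 / 2) ⟨le_rfl, by norm_num⟩)
  refine ⟨Real.sqrt (A₀ + 256), Real.sqrt_nonneg _, fun q hq => ?_⟩
  have hqI : q ∈ Set.Ioo (criticalProbI 2 : ℝ) 1 := ⟨by rw [hpc]; exact hq.1, by linarith [hq.2]⟩
  have hR := Thermo.sq_deriv_theta_le (d := 2) le_rfl hqI
  have hκ : deriv (deriv KAP) q ≤ A₀ := (le_abs_self _).trans (by simpa [Real.norm_eq_abs] using hA₀ q ⟨hq.1.le, hq.2.le⟩)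
  have hθ : 0 ≤ TH[q] := by unfold theta; exact measureReal_nonneg
  have hqq : (1 / 8 : ℝ) ≤ q * (1 - q) := by nlinarith [hq.1, hq.2]
  have hqq2 : (1 / 64 : ℝ) ≤ (q * (1 - q)) ^ 2 := by nlinarith [hqq]
  have hK : 2 * ((2 : ℕ) : ℝ) * (1 - TH[q]) / (q * (1 - q)) ^ 2 ≤ 256 := by
    rw [div_le_iff₀ (by positivity)]
    push_cast
    nlinarith [hqq2, hθ]
  have hχ0 : 0 ≤ CHI[q] := ENNReal.toReal_nonneg
  have hsq : (deriv (fun s : ℝ => TH[s]) q) ^ 2 ≤ (A₀ + 256) * CHI[q] := by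
    calc (deriv (fun s : ℝ => TH[s]) q) ^ 2
        ≤ CHI[q] * (deriv (deriv KAP) q + 2 * ((2 : ℕ) : ℝ) * (1 - TH[q]) / (q * (1 - q)) ^ 2) := hR
      _ ≤ CHI[q] * (A₀ + 256) := mul_le_mul_of_nonneg_left (add_le_add hκ hK) hχ0
      _ = (A₀ + 256) * CHI[q] := mul_comm _ _
  have hθ'0 : 0 ≤ deriv (fun s : ℝ => TH[s]) q := (ChiF.deriv_theta_pos (d := 2) le_rfl hqI.1 hqI.2).le
  calc deriv (fun s : ℝ => TH[s]) q = Real.sqrt ((deriv (fun s : ℝ => TH[s]) q) ^ 2) := (Real.sqrt_sq hθ'0).symm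
    _ ≤ Real.sqrt ((A₀ + 256) * CHI[q]) := Real.sqrt_le_sqrt hsq
    _ = Real.sqrt (A₀ + 256) * Real.sqrt CHI[q] := Real.sqrt_mul (by linarith) _

end ThermoZ2

end Summit.CriticalPhenomena.PercolationContinuityZ3.Theorems
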